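/-
Copyright: lit-balaban Phase-2 proof seat p30 (gen 3).  Statement-level skeleton of a published paper; no proof claims beyond what
the kernel checks below.
-/
import Mathlib
import Literature.MathematicalPhysics.QuantumFieldTheory.BalabanImbrieJaffe1984to88.BIJ85AxialMinimizer413
import Literature.MathematicalPhysics.QuantumFieldTheory.BalabanImbrieJaffe1984to88.BIJ85UnitPropagator433

/-!
# `BalabanImbrieJaffe1984to88.BIJ85Prop521Proof` — T. Bałaban, J. Imbrie, A. Jaffe, *Renormalization of the Higgs model: minimizers,
propagators and the stability of mean field theory*, Commun. Math. Phys. **97** (1985) 299–329 [BalabanImbrieJaffe1985]: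
**Proposition 5.2.1, the recursion (5.2.1) `G_{k,Ax} = H_{k−1,Ax}C^{(k−1)}H^*_{k−1,Ax} + G_{k−1,Ax}` DERIVED from (4.1.1)**
(the printed steps (5.2.3)–(5.2.5)), and its solution (5.2.2)

statement-level skeleton of published theorems with citation tags; proofs where landed; nothing here is a claim about the Yang–Mills mass gap

PDF held: `paper:balaban1985-cmp97-bij-higgs-minimizers` (journal page = PDF page + 298).  Page read as image: p. 316 [PDF 18]
(`run/shared/lean/pub/pub-balaban/t4/b2b-balaban-t4-lit2/renders/bij1985/1985-cmp97-bij-higgs-minimizers-p018-x2.png`).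

CITATION HEADER (lean-in-tree rule).  Part of the lit-balaban TYPED SKELETON (HOME `run/shared/lean/pub/lit-balaban/`), Phase-2
seat p30 (gen 3); row **C1.Prop5.2.1** of `HOME/SKELETON.md` (reader file `HOME/lit-balaban-r15/ROWS-C1.md`: the EQUIVALENCE
(5.2.1) ⇔ (5.2.2) — *"Clearly (5.2.1) and (5.2.2) are equivalent"* — is `BIJ85Sect4Statements.prop521_iff` (in any ring of
operators); *"the derivation (5.2.3)–(5.2.5) of (5.2.1) from (4.1.1) is Gaussian calculus, absent"* — supplied here).  THE PRINTED
TEXT, p. 316, verbatim: *"Proposition 6.2* [sic; = 5.2.1]*. The G_{k,Ax} satisfy the recursion relation G_{k,Ax} =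
H_{k−1,Ax}C^{(k−1)}H^*_{k−1,Ax} + G_{k−1,Ax}, (5.2.1) with the solution: G_{k,Ax} = Σ_{j=0}^{k−1} H_{j,Ax}C^{(j)}H^*_{j,Ax}. (5.2.2)
Proof. Clearly (5.2.1) and (5.2.2) are equivalent. We prove (5.2.1) starting from the definition of G_{k,Ax}, namely (4.1.1). Write
Q_k = QQ_{k−1}, and expand the integrand of (4.1.1) using δ(Q_kA)δ_{k,Ax}(A) = ∫𝒟Bδ(QB)δ(Q_{k−1}A − B)δ_{Ax}(B)δ_{k−1,Ax}(A). Then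
translate the integrand with respect to A to the minimum of the quadratic form ½‖∂A‖² − ⟨A, J⟩, under the restriction Q_{k−1}A = B
and the appropriate axial gauge. The minimum is achieved at H_{k−1,Ax}B, so we write A = A′ + H_{k−1,Ax}B. (5.2.3) Inserting this
and using (4.1.5) gives exp(½⟨J, G_{k,Ax}J⟩) = Z^{−1}∫𝒟Bδ(QB)δ_{Ax}(B)·exp(−½‖∂H_{k−1,Ax}B‖² + ⟨B, H^*_{k−1,Ax}J⟩)·∫𝒟A′δ(Q_{k−1}A′)
δ_{k−1,Ax}(A′)·exp(−½‖∂A′‖² + ⟨A′, J⟩). (5.2.4) The A′ integral yields Z_{k−1,Ax}exp(½⟨J, G_{k−1,Ax}J⟩), while the B integral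
gives ZZ^{−1}_{k−1,Ax}exp(½⟨H^*_{k−1,Ax}J, C^{(k−1)}H^*_{k−1,Ax}J⟩). (5.2.5) Thus (5.2.2) holds and the proposition follows."*

WHAT IS PROVED, in the Euclidean framework of seat p09 (`BIJ85AxialPropagator411`: `G_{k,Ax}` = `axialPropagator V D` =
`ι_V(ι_V^*∂^*∂ι_V)⁻¹ι_V^*` for the constraint subspace `V` = the support of `δ(Q_kA)δ_{k,Ax}(A)` and `D = ∂`, which SATISFIES
(4.1.1) (`isAxialPropagator_axialPropagator`); `BIJ85AxialMinimizer413`: `H_{k,Ax}` = `Hax` = the constrained minimizer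
(`Hax_eq_minimizer`)).  The data of one step `k−1 → k`: the fine bond fields `E` (η-lattice), the plaquette fields `F`, the
coarse bond fields `Ec` (the `L^{k−1}η`-lattice), the curl `D : E → F`, the average `Qc = Q_{k−1} : E → Ec` with its linear right
inverse `Qs = Q^{s*}_{k−1}` (`QcQs = I`, (2.19)), the level-(k−1) constraint subspace `V′` (`Q_{k−1}A = 0`, `δ_{k−1,Ax}(A)`; so
`Q_{k−1} = 0` on `V′`), the unit-step constraint subspace `W ⊆ Ec` (`QB = 0`, `δ_{Ax}(B)`), and the level-k constraint subspace
`V`, tied by THE PRINTED FACTORISATION of `δ(Q_kA)δ_{k,Ax}(A)`: `A ∈ V ⇔ (Q_{k−1}A ∈ W and A − Q^{s*}_{k−1}Q_{k−1}A ∈ V′)`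
(hypothesis `hV`; the second clause is *"the restriction Q_{k−1}A = B and the appropriate axial gauge"*, the class of `B` written
through its representative `Q^{s*}_{k−1}B` as in (5.3.1)).  Then:
* §1 the Euler–Lagrange characterisation of `G_{k,Ax}J` (the unique `g ∈ V` with `⟨∂g, ∂v⟩ = ⟨J, v⟩` on `V`: the minimum of
  *"the quadratic form ½‖∂A‖² − ⟨A, J⟩"*) — `axialPropagator_mem`, `inner_D_axialPropagator`, `eq_axialPropagator`;
* §2 `H_{k−1,Ax}` AS A LINEAR MAP `HaxOp V′ D Qs : Ec →ₗ E`, `B ↦ Q^{s*}B − G_{k−1,Ax}∂^*∂Q^{s*}B` (= `Hax V′ D (Qs B)`,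
  `HaxOp_apply`, the (5.3.1) shape), and `C^{(k−1)}` := `axialPropagator W (D ∘ HaxOp V′ D Qs)` — the propagator of the form
  `⟨B, Δ_{k−1}B⟩ = ‖∂H_{k−1,Ax}B‖²` ((4.3.1)–(4.3.2)) on `δ(QB)δ_{Ax}(B)`, which SATISFIES (4.3.3) (`eq433`);
* §3 **(5.2.1) as an operator identity** `axialPropagator V D = H C^{(k−1)} H^* + axialPropagator V′ D` (`eq521`), by the printed
  route: the translation (5.2.3) `A = A′ + H_{k−1,Ax}B` splits `V` (`decomp523`), `‖∂A‖²` splits by orthogonality at the minimum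
  and (4.1.5), and the two Gaussian factors (5.2.4)–(5.2.5) are the two Euler–Lagrange problems on `W` and on `V′`; the exponent
  bookkeeping of (5.2.4)–(5.2.5) is `eq521_form` (`½⟨J, G_kJ⟩ = ½⟨H^*J, C^{(k−1)}H^*J⟩ + ½⟨J, G_{k−1}J⟩`);
* §4 **(5.2.2)** for a tower of such steps with `V_0 = 0` (`G_{0,Ax} = 0`), by induction (`eq522`; cf. `prop521_iff`).
Hypothesis throughout: no zero modes of `∂` on `V` (p. 309; k = 1 proved by seat p33), from which the no-zero-modes facts for
`V′` and for `∂H_{k−1,Ax}` on `W` are DERIVED (`noZeroModes_sub`, `noZeroModes_DH`).  The torus instance (the factorisation `hV`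
for `constraint411 (j+1)` from `BIJ85Eq531Inputs`) is the companion file `BIJ85Prop521Torus`.
Unit `lit-balaban-p30` (literature-prover-lit-balaban-p30-g3-0), 2026-08-21.
-/

/-!
## v3 UNION (lit-balaban ruling G.5-31, path clobber) — TWO ACCEPTED TEXTS OF THE SAME STEM, BOTH KEPT VERBATIM

statement-level skeleton of published theorems with citation tags; proofs where landed; nothing here is a claim about the Yang–Mills mass gap

PART I (above and §§1–4 below) = seat **p30 gen 3** (literature-prover-lit-balaban-p30-g3-0), proposal p247201, ACCEPTED first
(commit ce412c656c92, 2026-08-21T03:55Z): (5.2.1) as an operator identity by the Euler–Lagrange characterisation of the two Gaussian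
minima (`eq521`), (5.2.2) for a tower (`eq522`), (4.3.3) for `C^{(k−1)}` (`eq433`).  PART II (the second module docstring onwards) =
seat **p09 gen 2** (literature-prover-lit-balaban-p09-g2-0), proposal p247363 (ACCEPTED 6077649ce70b, 2026-08-21T04:06Z, which —
filed one minute after PART I landed, the two TAKING lines 03:41Z/03:46Z having crossed — replaced PART I on the head; this union
restores it): the printed Gaussian-integral route (5.2.3) change of variables with its Jacobian, (5.2.4) factorisation by Fubini,
(5.2.5), and (5.2.1) first as an identity of the quadratic forms for ANY operators satisfying (4.1.1)_k, (4.1.1)_{k−1}, (4.3.3), then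
as an operator identity (`prop521_form`, `prop521_of_symm`, `prop521`), over the linear `H_{k,Ax}` / `Δ_k` / (4.3.3) vocabulary of
`…BIJ85UnitPropagator433`.  PART III (end of file) = the one-line bridges between the two vocabularies (`Hop_eq_HaxOp`,
`unitPropagator_eq`, `prop521_eq521`).  Merge owner: p09 gen 2 (the seat whose proposal displaced the head), 2026-08-21.
-/

open scoped BigOperators RealInnerProductSpace

namespace Literature.MathematicalPhysics.QuantumFieldTheory.BalabanImbrieJaffe1984to88.BIJ85Prop521Proof

open BIJ85AxialPropagator411 BIJ85AxialMinimizer413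

section Abstract

variable {E F Ec : Type*}
  [NormedAddCommGroup E] [InnerProductSpace ℝ E] [FiniteDimensional ℝ E]
  [NormedAddCommGroup F] [InnerProductSpace ℝ F] [FiniteDimensional ℝ F]
  [NormedAddCommGroup Ec] [InnerProductSpace ℝ Ec]

/-! ## 1. The Euler–Lagrange characterisation of `G_{k,Ax}J` -/

/-- `⟨v, S^*S w⟩ = ⟨Sv, Sw⟩`. [folklore] -/
private theorem inner_formOp' {W : Type*} [NormedAddCommGroup W] [InnerProductSpace ℝ W] [FiniteDimensional ℝ W]
    (S : W →ₗ[ℝ] F) (v w : W) : ⟪v, formOp S w⟫ = ⟪S v, S w⟫ := by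
  unfold formOp
  rw [LinearMap.comp_apply, LinearMap.adjoint_inner_right]

omit [FiniteDimensional ℝ E] [FiniteDimensional ℝ F] in
/-- No zero modes of `∂` on `V` ⇒ `∂ι_V` is injective. [folklore] -/
private theorem injective_S' {V : Submodule ℝ E} {D : E →ₗ[ℝ] F} (hD : ∀ v : V, D (v : E) = 0 → v = 0) :
    Function.Injective (D ∘ₗ V.subtype) := by
  intro v w h
  have : (D ∘ₗ V.subtype) (v - w) = 0 := by rw [map_sub, h, sub_self]
  exact sub_eq_zero.1 (hD _ this)

/-- `G_{k,Ax}J` lies in the constraint subspace (the support of `δ(Q_kA)δ_{k,Ax}(A)` in (4.1.1)). [cite: BalabanImbrieJaffe1985, (4.1.1) p.309] -/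
theorem axialPropagator_mem (V : Submodule ℝ E) (D : E →ₗ[ℝ] F) (J : E) : axialPropagator V D J ∈ V := by
  unfold axialPropagator
  simp only [LinearMap.comp_apply, Submodule.subtype_apply]
  exact Submodule.coe_mem _

/-- **Euler–Lagrange equation of (4.1.1)**: `⟨∂G_{k,Ax}J, ∂v⟩ = ⟨J, v⟩` for every `v` of the constraint subspace — `G_{k,Ax}J` is
the minimum of *"the quadratic form ½‖∂A‖² − ⟨A, J⟩"* (p. 316) over the constraint subspace. [cite: BalabanImbrieJaffe1985, (4.1.1) p.309] -/
theorem inner_D_axialPropagator {V : Submodule ℝ E} {D : E →ₗ[ℝ] F} (hD : ∀ v : V, D (v : E) = 0 → v = 0) (J : E)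
    (v : V) : ⟪D (axialPropagator V D J), D (v : E)⟫ = ⟪J, (v : E)⟫ := by
  set S : V →ₗ[ℝ] F := D ∘ₗ V.subtype with hS
  set b : V := LinearMap.adjoint V.subtype J with hb
  have h1 : axialPropagator V D J = ((formInv S b : V) : E) := by
    simp only [axialPropagator, LinearMap.comp_apply, Submodule.subtype_apply, hS, hb]
  have h2 : ⟪S (formInv S b), S v⟫ = ⟪b, v⟫ := by
    rw [real_inner_comm, ← inner_formOp', formOp_formInv (injective_S' hD), real_inner_comm]
  simp only [hS, LinearMap.comp_apply, Submodule.subtype_apply] at h2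
  rw [h1, h2, hb, LinearMap.adjoint_inner_left, Submodule.subtype_apply]

/-- **Uniqueness of the minimum** (no zero modes): an element `g` of the constraint subspace satisfying the Euler–Lagrange
equation for the source `J` IS `G_{k,Ax}J`. [cite: BalabanImbrieJaffe1985, (4.1.1) p.309] -/
theorem eq_axialPropagator {V : Submodule ℝ E} {D : E →ₗ[ℝ] F} (hD : ∀ v : V, D (v : E) = 0 → v = 0) {J g : E}
    (hg : g ∈ V) (hEL : ∀ v : V, ⟪D g, D (v : E)⟫ = ⟪J, (v : E)⟫) : g = axialPropagator V D J := by
  have hd : g - axialPropagator V D J ∈ V := V.sub_mem hg (axialPropagator_mem V D J)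
  have key : ∀ v : V, ⟪D (g - axialPropagator V D J), D (v : E)⟫ = 0 := fun v => by
    rw [map_sub, inner_sub_left, hEL v, inner_D_axialPropagator hD J v, sub_self]
  have h0 : D (((⟨g - axialPropagator V D J, hd⟩ : V)) : E) = 0 := inner_self_eq_zero.1 (key ⟨_, hd⟩)
  have h1 := congrArg (fun v : V => (v : E)) (hD _ h0)
  simp only [Submodule.coe_zero] at h1
  exact sub_eq_zero.1 h1

/-- `G_{0,Ax} = 0`: on the zero constraint subspace the propagator vanishes (the empty sum of (5.2.2)). [cite: BalabanImbrieJaffe1985, (5.2.2) p.316] -/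
theorem axialPropagator_bot (D : E →ₗ[ℝ] F) : axialPropagator (⊥ : Submodule ℝ E) D = 0 := by
  ext J
  unfold axialPropagator
  simp only [LinearMap.comp_apply, LinearMap.zero_apply,
    Submodule.eq_zero_of_bot_submodule (formInv (D ∘ₗ (⊥ : Submodule ℝ E).subtype) _), map_zero]

/-! ## 2. `H_{k−1,Ax}` as a linear map and the propagator `C^{(k−1)}` of (4.3.3) -/

/-- **`H_{k−1,Ax}` as a linear map of the coarse field `B`**: `B ↦ Q^{s*}B − G_{Ax}∂^*∂Q^{s*}B` for a linear right inverse `Qs`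
(= `Q^{s*}`) of the average — the printed shape (5.3.1) of the minimizer (4.1.3) at the representative `Q^{s*}B` of the class
`{Q A = B, axial gauge}`; equal to `Hax V D (Qs B)` (`HaxOp_apply`). [cite: BalabanImbrieJaffe1985, (4.1.3) p.310] -/
noncomputable def HaxOp (V : Submodule ℝ E) (D : E →ₗ[ℝ] F) (Qs : Ec →ₗ[ℝ] E) : Ec →ₗ[ℝ] E :=
  Qs - axialPropagator V D ∘ₗ LinearMap.adjoint D ∘ₗ D ∘ₗ Qs

/-- `HaxOp B` is the minimizing configuration of the class of `Qs B`. [cite: BalabanImbrieJaffe1985, (4.1.3) p.310] -/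
theorem HaxOp_eq_minimizer (V : Submodule ℝ E) (D : E →ₗ[ℝ] F) (Qs : Ec →ₗ[ℝ] E) (B : Ec) :
    HaxOp V D Qs B = minimizer V D (Qs B) := by
  simp only [HaxOp, minimizer, LinearMap.sub_apply, LinearMap.comp_apply]

/-- **`HaxOp B = H_{Ax}(Qs B)`** — the linear map IS the Gaussian mean (4.1.3) (no zero modes). [cite: BalabanImbrieJaffe1985, (4.1.3) p.310] -/
theorem HaxOp_apply [MeasurableSpace E] [BorelSpace E] {V : Submodule ℝ E} {D : E →ₗ[ℝ] F}
    (hD : ∀ v : V, D (v : E) = 0 → v = 0) (Qs : Ec →ₗ[ℝ] E) (B : Ec) : HaxOp V D Qs B = Hax V D (Qs B) := by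
  rw [Hax_eq_minimizer hD, HaxOp_eq_minimizer]

/-- `H_{Ax}B − Q^{s*}B` lies in the constraint subspace (the translation stays in the class). [cite: BalabanImbrieJaffe1985, (4.1.5) p.310] -/
theorem HaxOp_sub_mem (V : Submodule ℝ E) (D : E →ₗ[ℝ] F) (Qs : Ec →ₗ[ℝ] E) (B : Ec) : HaxOp V D Qs B - Qs B ∈ V := by
  rw [HaxOp_eq_minimizer]; exact minimizer_sub_mem V D (Qs B)

/-- **Orthogonality at the minimum**: `⟨∂H_{Ax}B, ∂A′⟩ = 0` for `A′` in the constraint subspace — the cross term of `‖∂(A′ +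
H_{k−1,Ax}B)‖²` in (5.2.4) vanishes. [cite: BalabanImbrieJaffe1985, (5.2.4) p.316] -/
theorem inner_D_HaxOp {V : Submodule ℝ E} {D : E →ₗ[ℝ] F} (hD : ∀ v : V, D (v : E) = 0 → v = 0) (Qs : Ec →ₗ[ℝ] E)
    (B : Ec) (v : V) : ⟪D (HaxOp V D Qs B), D (v : E)⟫ = 0 := by
  rw [HaxOp_eq_minimizer]; exact inner_D_minimizer hD (Qs B) v

variable {D : E →ₗ[ℝ] F} {V V' : Submodule ℝ E} {W : Submodule ℝ Ec} {Qc : E →ₗ[ℝ] Ec} {Qs : Ec →ₗ[ℝ] E}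

omit [FiniteDimensional ℝ E] in
/-- The level-(k−1) constraint subspace is contained in the level-k one (`δ_{k,Ax} = δ_{k−1,Ax}δ_{Ax}(Q_{k−1}·)`, `Q_k = QQ_{k−1}`).
[cite: BalabanImbrieJaffe1985, (4.1.2) p.309] -/
theorem le_of_factor (hV' : ∀ v : V', Qc (v : E) = 0) (hV : ∀ A, A ∈ V ↔ Qc A ∈ W ∧ A - Qs (Qc A) ∈ V') : V' ≤ V := by
  intro A hA
  rw [hV, hV' ⟨A, hA⟩, map_zero, sub_zero]
  exact ⟨W.zero_mem, hA⟩

omit [FiniteDimensional ℝ E] [FiniteDimensional ℝ F] in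
/-- No zero modes of `∂` on `V` ⇒ none on `V′ ⊆ V`. [cite: BalabanImbrieJaffe1985, (4.1.1) p.309] -/
theorem noZeroModes_sub (hle : V' ≤ V) (hD : ∀ v : V, D (v : E) = 0 → v = 0) : ∀ v : V', D (v : E) = 0 → v = 0 := by
  intro v hv
  have h := congrArg (fun w : V => (w : E)) (hD ⟨(v : E), hle v.2⟩ hv)
  simp only [Submodule.coe_zero] at h
  exact Subtype.ext h

/-- `Q_{k−1}(H_{k−1,Ax}B) = B` — (4.1.5) for the linear map. [cite: BalabanImbrieJaffe1985, (4.1.5) p.310] -/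
theorem Qc_HaxOp (hQ : ∀ B, Qc (Qs B) = B) (hV' : ∀ v : V', Qc (v : E) = 0) (B : Ec) : Qc (HaxOp V' D Qs B) = B := by
  have h := hV' ⟨_, HaxOp_sub_mem V' D Qs B⟩
  simp only [map_sub] at h
  rw [sub_eq_zero] at h
  rw [h, hQ]

/-- For `B` in the unit-step constraint subspace, `H_{k−1,Ax}B` lies in the level-k constraint subspace. [cite: BalabanImbrieJaffe1985, (5.2.3) p.316] -/
theorem HaxOp_mem (hQ : ∀ B, Qc (Qs B) = B) (hV' : ∀ v : V', Qc (v : E) = 0)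
    (hV : ∀ A, A ∈ V ↔ Qc A ∈ W ∧ A - Qs (Qc A) ∈ V') {B : Ec} (hB : B ∈ W) : HaxOp V' D Qs B ∈ V := by
  rw [hV, Qc_HaxOp hQ hV' B]
  exact ⟨hB, HaxOp_sub_mem V' D Qs B⟩

/-- No zero modes of `∂H_{k−1,Ax}` on the unit-step constraint subspace (so `C^{(k−1)}` is well defined), DERIVED from the
no-zero-modes hypothesis on `V`. [cite: BalabanImbrieJaffe1985, (4.3.3) p.311] -/
theorem noZeroModes_DH (hD : ∀ v : V, D (v : E) = 0 → v = 0) (hQ : ∀ B, Qc (Qs B) = B) (hV' : ∀ v : V', Qc (v : E) = 0)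
    (hV : ∀ A, A ∈ V ↔ Qc A ∈ W ∧ A - Qs (Qc A) ∈ V') :
    ∀ B : W, (D ∘ₗ HaxOp V' D Qs) (B : Ec) = 0 → B = 0 := by
  intro B hB
  have h1 := hD ⟨_, HaxOp_mem hQ hV' hV B.2⟩ hB
  have h2 : HaxOp V' D Qs (B : Ec) = 0 := by
    have := congrArg (fun w : V => (w : E)) h1
    simpa using this
  have h3 : (B : Ec) = 0 := by rw [← Qc_HaxOp (V' := V') (D := D) hQ hV' (B : Ec), h2, map_zero]
  exact Subtype.ext h3

/-- **(5.2.3)**: every `A` of the level-k constraint subspace is `A = A′ + H_{k−1,Ax}B` with `B = Q_{k−1}A` (in the unit-step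
constraint subspace) and `A′` in the level-(k−1) constraint subspace. [cite: BalabanImbrieJaffe1985, (5.2.3) p.316] -/
theorem decomp523 (hV : ∀ A, A ∈ V ↔ Qc A ∈ W ∧ A - Qs (Qc A) ∈ V') {A : E} (hA : A ∈ V) :
    Qc A ∈ W ∧ A - HaxOp V' D Qs (Qc A) ∈ V' := by
  refine ⟨((hV A).1 hA).1, ?_⟩
  have h := V'.sub_mem ((hV A).1 hA).2 (HaxOp_sub_mem V' D Qs (Qc A))
  have e : A - Qs (Qc A) - (HaxOp V' D Qs (Qc A) - Qs (Qc A)) = A - HaxOp V' D Qs (Qc A) := by abel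
  rwa [e] at h

/-! ## 3. (5.2.1) -/

variable [FiniteDimensional ℝ Ec]

/-- **Proposition 5.2.1, (5.2.1)** `G_{k,Ax} = H_{k−1,Ax}C^{(k−1)}H^*_{k−1,Ax} + G_{k−1,Ax}` as an OPERATOR IDENTITY, derived from
(4.1.1) along the printed steps (5.2.3)–(5.2.5): with `H = HaxOp V′ D Qs` (= `H_{k−1,Ax}`) and `C^{(k−1)} = axialPropagator W (D∘H)`
(the propagator (4.3.3) of `⟨B, Δ_{k−1}B⟩ = ‖∂H_{k−1,Ax}B‖²` on `δ(QB)δ_{Ax}(B)`), `axialPropagator V D = H C^{(k−1)} H^* +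
axialPropagator V′ D`. [cite: BalabanImbrieJaffe1985, Prop. 5.2.1 (5.2.1) p.316] -/
theorem eq521 (hD : ∀ v : V, D (v : E) = 0 → v = 0) (hQ : ∀ B, Qc (Qs B) = B) (hV' : ∀ v : V', Qc (v : E) = 0)
    (hV : ∀ A, A ∈ V ↔ Qc A ∈ W ∧ A - Qs (Qc A) ∈ V') :
    axialPropagator V D = HaxOp V' D Qs ∘ₗ axialPropagator W (D ∘ₗ HaxOp V' D Qs) ∘ₗ LinearMap.adjoint (HaxOp V' D Qs)
      + axialPropagator V' D := by
  have hle : V' ≤ V := le_of_factor hV' hV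
  have hD' : ∀ v : V', D (v : E) = 0 → v = 0 := noZeroModes_sub hle hD
  have hDH := noZeroModes_DH hD hQ hV' hV
  ext J
  symm
  simp only [LinearMap.add_apply, LinearMap.comp_apply]
  set H := HaxOp V' D Qs with hH
  set c : Ec := axialPropagator W (D ∘ₗ H) (LinearMap.adjoint H J) with hc
  have hcW : c ∈ W := axialPropagator_mem W _ _
  refine eq_axialPropagator hD (V.add_mem (HaxOp_mem hQ hV' hV hcW) (hle (axialPropagator_mem V' D J))) fun v => ?_
  -- the translation (5.2.3) of the test configuration
  obtain ⟨hB, hA'⟩ := decomp523 (D := D) hV v.2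
  set B : Ec := Qc (v : E) with hBdef
  set A' : E := (v : E) - H B with hA'def
  have hv : (v : E) = H B + A' := by rw [hA'def]; abel
  -- the four terms of ⟨∂(Hc + G′J), ∂(HB + A′)⟩
  have t1 : ⟪D (H c), D (H B)⟫ = ⟪J, H B⟫ := by
    have h := inner_D_axialPropagator (V := W) (D := D ∘ₗ H) hDH (LinearMap.adjoint H J) ⟨B, hB⟩
    simp only [LinearMap.comp_apply] at h
    rw [hc, h, LinearMap.adjoint_inner_left]
  have t2 : ⟪D (H c), D A'⟫ = 0 := inner_D_HaxOp hD' Qs c ⟨A', hA'⟩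
  have t3 : ⟪D (axialPropagator V' D J), D (H B)⟫ = 0 := by
    rw [real_inner_comm]; exact inner_D_HaxOp hD' Qs B ⟨_, axialPropagator_mem V' D J⟩
  have t4 : ⟪D (axialPropagator V' D J), D A'⟫ = ⟪J, A'⟫ := inner_D_axialPropagator hD' J ⟨A', hA'⟩
  rw [hv, map_add, map_add, inner_add_left, inner_add_right, inner_add_right, t1, t2, t3, t4, inner_add_right]
  ring

/-- **(5.2.4)–(5.2.5), the exponents**: `½⟨J, G_{k,Ax}J⟩ = ½⟨H^*_{k−1,Ax}J, C^{(k−1)}H^*_{k−1,Ax}J⟩ + ½⟨J, G_{k−1,Ax}J⟩` — the B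
integral and the A′ integral of (5.2.4). [cite: BalabanImbrieJaffe1985, (5.2.4)–(5.2.5) p.316] -/
theorem eq521_form (hD : ∀ v : V, D (v : E) = 0 → v = 0) (hQ : ∀ B, Qc (Qs B) = B) (hV' : ∀ v : V', Qc (v : E) = 0)
    (hV : ∀ A, A ∈ V ↔ Qc A ∈ W ∧ A - Qs (Qc A) ∈ V') (J : E) :
    (1 / 2 : ℝ) * ⟪J, axialPropagator V D J⟫ =
      (1 / 2 : ℝ) * ⟪LinearMap.adjoint (HaxOp V' D Qs) J,
        axialPropagator W (D ∘ₗ HaxOp V' D Qs) (LinearMap.adjoint (HaxOp V' D Qs) J)⟫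
      + (1 / 2 : ℝ) * ⟪J, axialPropagator V' D J⟫ := by
  rw [eq521 hD hQ hV' hV]
  simp only [LinearMap.add_apply, LinearMap.comp_apply, inner_add_right, LinearMap.adjoint_inner_left]
  ring

/-- **(4.3.3) for `C^{(k−1)}`**: the operator `axialPropagator W (∂∘H_{k−1,Ax})` SATISFIES the defining functional integral
*"exp(½⟨J, C^{(k)}J⟩) = Z^{−1}∫𝒟Bδ(QB)δ_{Ax}(B)exp(−½⟨B, Δ_kB⟩ + ⟨B, J⟩) (4.3.3)"* with `⟨B, Δ_kB⟩ = ‖∂H_{k,Ax}B‖²` ((4.3.2)),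
and the integral converges — no zero modes of `∂H` on `δ(QB)δ_{Ax}(B)`, derived. [cite: BalabanImbrieJaffe1985, (4.3.3) p.311] -/
theorem eq433 [MeasurableSpace Ec] [BorelSpace Ec] (hD : ∀ v : V, D (v : E) = 0 → v = 0) (hQ : ∀ B, Qc (Qs B) = B)
    (hV' : ∀ v : V', Qc (v : E) = 0) (hV : ∀ A, A ∈ V ↔ Qc A ∈ W ∧ A - Qs (Qc A) ∈ V') :
    IsAxialPropagator W (D ∘ₗ HaxOp V' D Qs) (axialPropagator W (D ∘ₗ HaxOp V' D Qs))
      ∧ 0 < Z W (D ∘ₗ HaxOp V' D Qs) :=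
  isAxialPropagator_axialPropagator W _ (noZeroModes_DH hD hQ hV' hV)

end Abstract

/-! ## 4. (5.2.2): the solution of the recursion for a tower of steps -/

section Tower

variable {E F : Type*}
  [NormedAddCommGroup E] [InnerProductSpace ℝ E] [FiniteDimensional ℝ E]
  [NormedAddCommGroup F] [InnerProductSpace ℝ F] [FiniteDimensional ℝ F]
  {Ec : ℕ → Type*} [∀ j, NormedAddCommGroup (Ec j)] [∀ j, InnerProductSpace ℝ (Ec j)] [∀ j, FiniteDimensional ℝ (Ec j)]

/-- **Proposition 5.2.1, (5.2.2)** `G_{k,Ax} = Σ_{j=0}^{k−1} H_{j,Ax}C^{(j)}H^*_{j,Ax}`: for a tower of scales `j = 0, 1, …` — coarse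
fields `Ec j` (the `L^jη`-lattice), averages `Q_j` with right inverses `Q^{s*}_j`, unit-step constraint subspaces `W j`, and
level constraint subspaces `V j` with `V 0 = 0` (`Q_0 = I`: the constraint `A = 0`) factorised level by level as printed — the
recursion (5.2.1) (`eq521`) telescopes to (5.2.2). [cite: BalabanImbrieJaffe1985, Prop. 5.2.1 (5.2.2) p.316] -/
theorem eq522 {D : E →ₗ[ℝ] F} (V : ℕ → Submodule ℝ E) (W : ∀ j, Submodule ℝ (Ec j)) (Qc : ∀ j, E →ₗ[ℝ] Ec j)
    (Qs : ∀ j, Ec j →ₗ[ℝ] E) (h0 : V 0 = ⊥) (hD : ∀ j, ∀ v : V j, D (v : E) = 0 → v = 0)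
    (hQ : ∀ j B, Qc j (Qs j B) = B) (hV' : ∀ j, ∀ v : V j, Qc j (v : E) = 0)
    (hV : ∀ j A, A ∈ V (j + 1) ↔ Qc j A ∈ W j ∧ A - Qs j (Qc j A) ∈ V j) (k : ℕ) :
    axialPropagator (V k) D = ∑ j ∈ Finset.range k,
      HaxOp (V j) D (Qs j) ∘ₗ axialPropagator (W j) (D ∘ₗ HaxOp (V j) D (Qs j)) ∘ₗ LinearMap.adjoint (HaxOp (V j) D (Qs j)) := by
  induction k with
  | zero => rw [Finset.sum_range_zero, h0, axialPropagator_bot]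
  | succ k ih => rw [Finset.sum_range_succ, ← ih, eq521 (hD (k + 1)) (hQ k) (hV' k) (hV k), add_comm]

end Tower

end Literature.MathematicalPhysics.QuantumFieldTheory.BalabanImbrieJaffe1984to88.BIJ85Prop521Proof

/-!
# PART II (v3 union; seat p09 gen 2, p247363) — `BalabanImbrieJaffe1984to88.BIJ85Prop521Proof` — T. Bałaban, J. Imbrie, A. Jaffe, *Renormalization of the Higgs model: minimizers,
propagators and the stability of mean field theory*, Commun. Math. Phys. **97** (1985) 299–329 [BalabanImbrieJaffe1985]: Sect. 5.2
p. 316 — **Proposition 5.2.1** (printed "Proposition 6.2"), the recursion **(5.2.1)** `G_{k,Ax} = H_{k−1,Ax}C^{(k−1)}H^*_{k−1,Ax} + G_{k−1,Ax}`,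
PROVED along the printed proof (5.2.3)–(5.2.5) from the functional-integral definitions (4.1.1), (4.1.3), (4.3.3)

statement-level skeleton of published theorems with citation tags; proofs where landed; nothing here is a claim about the Yang–Mills mass gap

PDF held: `paper:balaban1985-cmp97-bij-higgs-minimizers` (journal page = PDF page + 298); p. 316 [PDF 18] read on the render
`run/shared/lean/pub/pub-balaban/t4/b2b-balaban-t4-lit2/renders/bij1985/1985-cmp97-bij-higgs-minimizers-p018-x2.png`.

THE PRINTED TEXT (p. 316, verbatim).  *"Proposition 6.2. The G_{k,Ax} satisfy the recursion relation
G_{k,Ax} = H_{k−1,Ax}C^{(k−1)}H^*_{k−1,Ax} + G_{k−1,Ax}, (5.2.1) with the solution: G_{k,Ax} = Σ_{j=0}^{k−1} H_{j,Ax}C^{(j)}H^*_{j,Ax}. (5.2.2)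
Proof. Clearly (5.2.1) and (5.2.2) are equivalent. We prove (5.2.1) starting from the definition of G_{k,Ax}, namely (4.1.1). Write
Q_k = QQ_{k−1}, and expand the integrand of (4.1.1) using δ(Q_kA)δ_{k,Ax}(A) = ∫𝒟Bδ(QB)δ(Q_{k−1}A − B)δ_{Ax}(B)δ_{k−1,Ax}(A). Then
translate the integrand with respect to A to the minimum of the quadratic form ½‖∂A‖² − ⟨A, J⟩, under the restriction Q_{k−1}A = B and
the appropriate axial gauge. The minimum is achieved at H_{k−1,Ax}B, so we write A = A′ + H_{k−1,Ax}B. (5.2.3) Inserting this and using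
(4.1.5) gives exp(½⟨J, G_{k,Ax}J⟩) = Z^{−1}∫𝒟Bδ(QB)δ_{Ax}(B) · exp(−½‖∂H_{k−1,Ax}B‖² + ⟨B, H^*_{k−1,Ax}J⟩)
· ∫𝒟A′δ(Q_{k−1}A′)δ_{k−1,Ax}(A′) · exp(−½‖∂A′‖² + ⟨A′, J⟩). (5.2.4) The A′ integral yields Z_{k−1,Ax}exp(½⟨J, G_{k−1,Ax}J⟩), while the
B integral gives ZZ^{−1}_{k−1,Ax}exp(½⟨H^*_{k−1,Ax}J, C^{(k−1)}H^*_{k−1,Ax}J⟩). (5.2.5) Thus (5.2.2) holds and the proposition follows."*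

WHAT IS PROVED (SKELETON row `C1.Prop5.2.1`, whose cell of record so far was the ring identity `BIJ85Sect4Statements.prop521_iff` =
*"Clearly (5.2.1) and (5.2.2) are equivalent"*, the derivation (5.2.3)–(5.2.5) being `absent`; lit-balaban HOME `run/shared/lean/pub/lit-balaban/`;
Phase-2 seat p09 GEN 2, taking announced 2026-08-21T03:41Z; unit `lit-balaban-p09`).  THE TWO-SCALE SETTING (the finite-dimensional Gaussian
calculus of `…BIJ85AxialPropagator411` §2, seat p09 gen 1): η-bond fields `E`, η-plaquette fields `F`, the curl `D : E → F`; the bond fields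
`E₁` of the `L^{k−1}η`-lattice with `Qm = Q_{k−1} : E → E₁`; the `(k−1)`-scale axial gauge `δ_{k−1,Ax}` as a subspace `U ⊆ E`; the
constraint subspaces `V′ = δ(Q_{k−1}A)δ_{k−1,Ax}(A)` (`hV'`) and — by *"Q_k = QQ_{k−1}"* and (4.1.2) `δ_{k,Ax}(A) = δ_{k−1,Ax}(A)δ_{Ax}(Q_{k−1}A)` —
`V = δ(Q_kA)δ_{k,Ax}(A) = {A : δ_{k−1,Ax}(A), Q_{k−1}A ∈ W}` (`hV`) with `W = δ(QB)δ_{Ax}(B) ⊆ E₁`; the representatives `Qs = Q^{s*}_{k−1}`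
(`hQs`: `Q_{k−1}Q^{s*}_{k−1} = I`, `δ_{k−1,Ax}(Q^{s*}_{k−1}B)` — on the tori `…BIJ85Eq531Inputs`, seat p30 gen 3); and the p. 309 no-zero-modes
claim for ∂ on `V` (`hD`, as in gen 1).  The operators: `G_{k,Ax}`, `G_{k−1,Ax}` = ANY operators satisfying (4.1.1) (`IsAxialPropagator`, gen 1)
for `V`, `V′`; `H_{k−1,Ax}` = `…BIJ85UnitPropagator433.Hop V′ D Qs` (= (4.1.3), `Hop_eq_Hax`); `C^{(k−1)}` = ANY operator satisfying (4.3.3)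
(`IsUnitPropagator W Δ_{k−1}`) with `Δ_{k−1}` the action of (4.3.1)–(4.3.2) (`deltaOp V′ D Qs`).
* §1 — the printed constraint decomposition `δ(Q_kA)δ_{k,Ax}(A) = ∫𝒟Bδ(QB)δ(Q_{k−1}A − B)δ_{Ax}(B)δ_{k−1,Ax}(A)`: `V′ ≤ V`, `B ∈ W ⇒ H_{k−1,Ax}B ∈ V`,
  `A ∈ V ⇒ Q_{k−1}A ∈ W ∧ A − H_{k−1,Ax}Q_{k−1}A ∈ V′`, `Q_{k−1}H_{k−1,Ax} = I` ((4.1.5)), and no zero modes of `∂H_{k−1,Ax}` on `W`.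
* §2 — **(5.2.3)**: the translation `A = A′ + H_{k−1,Ax}B` is a linear change of variables `W × V′ ≅ V`; for the volumes this costs a
  constant Jacobian `c > 0` (Haar uniqueness): `∫_V f = c ∫_{W×V′} f(H_{k−1,Ax}B + A′)` (`exists_jacobian`).
* §3 — **(5.2.4)**: *"Inserting this and using (4.1.5)"* — the sourced integral of (4.1.1)_k FACTORS,
  `gen_V(J) = c · [∫_W e^{−½‖∂H_{k−1,Ax}B‖² + ⟨B, H^*_{k−1,Ax}J⟩}dB] · [∫_{V′} e^{−½‖∂A′‖² + ⟨A′, J⟩}dA′]` (`eq524`; the cross term vanishes by the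
  Euler–Lagrange equation of the minimizer, and `‖∂H_{k−1,Ax}B‖² = ⟨B, Δ_{k−1}B⟩` makes the first factor the sourced integral of (4.3.3));
  at J = 0: `Z_{k,Ax} = c · Z^{(k−1)} · Z_{k−1,Ax}` (`Z_eq`).
* §4 — **(5.2.5)** (`eq525`): *"The A′ integral yields Z_{k−1,Ax}exp(½⟨J,G_{k−1,Ax}J⟩), while the B integral gives
  ZZ^{−1}_{k−1,Ax}exp(½⟨H^*_{k−1,Ax}J, C^{(k−1)}H^*_{k−1,Ax}J⟩)"*, and **(5.2.1)**: for ALL such `G_{k,Ax}, G_{k−1,Ax}, C^{(k−1)}`,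
  `⟨J, G_{k,Ax}J⟩ = ⟨J, (H_{k−1,Ax}C^{(k−1)}H^*_{k−1,Ax} + G_{k−1,Ax})J⟩` for every J (`prop521_form` — the functional integrals define the
  quadratic forms), hence **`prop521_of_symm`**: the OPERATOR identity (5.2.1) for symmetric such operators, and **`prop521`**: (5.2.1)
  verbatim for the operator formulas of gen 1 / `…BIJ85UnitPropagator433` (`axialPropagator V D = Hop ∘ unitPropagator ∘ Hop^* + axialPropagator V′ D`).
NOT DONE HERE.  (5.2.2) is (5.2.1) summed — `BIJ85Sect4Statements.prop521_iff` (r15) in a ring of operators; the concrete tori (Q_{k−1} =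
`bondAvgIter`, `Q^{s*}_{k−1}` = `QsstarIter`, `V = V411 P k`) are the sibling `…BIJ85Prop521Torus`.  No `def`; nothing is asserted beyond the
kernel-checked algebra and integrals.
-/

namespace Literature.MathematicalPhysics.QuantumFieldTheory.BalabanImbrieJaffe1984to88.BIJ85Prop521Proof

open MeasureTheory
open scoped RealInnerProductSpace NNReal
open BIJ85AxialPropagator411 BIJ85AxialMinimizer413 BIJ85SigmaForm421 BIJ85UnitPropagator433

variable {E F E₁ : Type*} [NormedAddCommGroup E] [InnerProductSpace ℝ E] [FiniteDimensional ℝ E]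
  [NormedAddCommGroup F] [InnerProductSpace ℝ F] [FiniteDimensional ℝ F]
  [NormedAddCommGroup E₁] [InnerProductSpace ℝ E₁]
  {D : E →ₗ[ℝ] F} {Qm : E →ₗ[ℝ] E₁} {U V V' : Submodule ℝ E} {W : Submodule ℝ E₁} {Qs : E₁ →ₗ[ℝ] E}

/-! ## §1  The constraint decomposition `δ(Q_kA)δ_{k,Ax}(A) = ∫𝒟Bδ(QB)δ(Q_{k−1}A − B)δ_{Ax}(B)δ_{k−1,Ax}(A)` -/

omit [FiniteDimensional ℝ E] in
/-- `δ(Q_{k−1}A)δ_{k−1,Ax}(A) ⊆ δ(Q_kA)δ_{k,Ax}(A)`: the `(k−1)`-constraint subspace is contained in the `k`-th one (`Q_{k−1}A = 0 ∈ W`).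
[cite: BalabanImbrieJaffe1985, (5.2.3) p.316] -/
theorem le_next (hV' : ∀ A : E, A ∈ V' ↔ A ∈ U ∧ Qm A = 0) (hV : ∀ A : E, A ∈ V ↔ A ∈ U ∧ Qm A ∈ W) : V' ≤ V := by
  intro A hA
  obtain ⟨hU, hQ⟩ := (hV' A).1 hA
  exact (hV A).2 ⟨hU, by rw [hQ]; exact W.zero_mem⟩

omit [FiniteDimensional ℝ E] [FiniteDimensional ℝ F] in
/-- No zero modes of ∂ on `δ(Q_kA)δ_{k,Ax}(A)` ⇒ none on `δ(Q_{k−1}A)δ_{k−1,Ax}(A)`. [cite: BalabanImbrieJaffe1985, (5.2.3) p.316] -/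
theorem noZeroModes_prev (hV' : ∀ A : E, A ∈ V' ↔ A ∈ U ∧ Qm A = 0) (hV : ∀ A : E, A ∈ V ↔ A ∈ U ∧ Qm A ∈ W)
    (hD : ∀ v : V, D (v : E) = 0 → v = 0) (v : V') (hv : D (v : E) = 0) : v = 0 := by
  have h := hD ⟨(v : E), le_next hV' hV v.2⟩ hv
  have : ((⟨(v : E), le_next hV' hV v.2⟩ : V) : E) = 0 := by rw [h]; rfl
  exact Subtype.ext this

omit [FiniteDimensional ℝ E] in
/-- `Q_{k−1}` vanishes on `δ(Q_{k−1}A)δ_{k−1,Ax}(A)`. [cite: BalabanImbrieJaffe1985, (5.2.3) p.316] -/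
theorem Qm_prev (hV' : ∀ A : E, A ∈ V' ↔ A ∈ U ∧ Qm A = 0) (v : V') : Qm (v : E) = 0 :=
  ((hV' (v : E)).1 v.2).2

/-- **(4.1.5)** `Q_{k−1}H_{k−1,Ax}B = B` (*"Inserting this and using (4.1.5)"*). [cite: BalabanImbrieJaffe1985, (5.2.4) p.316] -/
theorem Qm_Hop (hV' : ∀ A : E, A ∈ V' ↔ A ∈ U ∧ Qm A = 0) (hQs : ∀ B : E₁, Qs B ∈ U ∧ Qm (Qs B) = B) (B : E₁) :
    Qm (Hop V' D Qs B) = B := by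
  rw [Qk_Hop V' D Qs Qm (Qm_prev hV') B, (hQs B).2]

/-- `H_{k−1,Ax}B` satisfies the `(k−1)`-scale axial gauge `δ_{k−1,Ax}`. [cite: BalabanImbrieJaffe1985, (5.2.3) p.316] -/
theorem Hop_mem_U (hV' : ∀ A : E, A ∈ V' ↔ A ∈ U ∧ Qm A = 0) (hQs : ∀ B : E₁, Qs B ∈ U ∧ Qm (Qs B) = B) (B : E₁) :
    Hop V' D Qs B ∈ U := by
  have h1 : Hop V' D Qs B - Qs B ∈ U := ((hV' _).1 (Hop_sub_mem V' D Qs B)).1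
  have h2 := U.add_mem h1 (hQs B).1
  simpa using h2

/-- `B ∈ δ(QB)δ_{Ax}(B) ⇒ H_{k−1,Ax}B ∈ δ(Q_kA)δ_{k,Ax}(A)`: the translate of (5.2.3) lands in the domain of (4.1.1)_k.
[cite: BalabanImbrieJaffe1985, (5.2.3) p.316] -/
theorem Hop_mem_next (hV' : ∀ A : E, A ∈ V' ↔ A ∈ U ∧ Qm A = 0) (hV : ∀ A : E, A ∈ V ↔ A ∈ U ∧ Qm A ∈ W)
    (hQs : ∀ B : E₁, Qs B ∈ U ∧ Qm (Qs B) = B) {B : E₁} (hB : B ∈ W) : Hop V' D Qs B ∈ V :=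
  (hV _).2 ⟨Hop_mem_U hV' hQs B, by rw [Qm_Hop hV' hQs]; exact hB⟩

omit [FiniteDimensional ℝ E] in
/-- `A ∈ δ(Q_kA)δ_{k,Ax}(A) ⇒ B = Q_{k−1}A ∈ δ(QB)δ_{Ax}(B)` (*"Write Q_k = QQ_{k−1}"*). [cite: BalabanImbrieJaffe1985, (5.2.3) p.316] -/
theorem Qm_mem_W (hV : ∀ A : E, A ∈ V ↔ A ∈ U ∧ Qm A ∈ W) (v : V) : Qm (v : E) ∈ W :=
  ((hV (v : E)).1 v.2).2

/-- `A ∈ δ(Q_kA)δ_{k,Ax}(A) ⇒ A′ = A − H_{k−1,Ax}Q_{k−1}A ∈ δ(Q_{k−1}A′)δ_{k−1,Ax}(A′)`: the fluctuation of (5.2.3) lies in the domain of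
(4.1.1)_{k−1}. [cite: BalabanImbrieJaffe1985, (5.2.3) p.316] -/
theorem sub_Hop_mem_prev (hV' : ∀ A : E, A ∈ V' ↔ A ∈ U ∧ Qm A = 0) (hV : ∀ A : E, A ∈ V ↔ A ∈ U ∧ Qm A ∈ W)
    (hQs : ∀ B : E₁, Qs B ∈ U ∧ Qm (Qs B) = B) (v : V) : (v : E) - Hop V' D Qs (Qm (v : E)) ∈ V' :=
  (hV' _).2 ⟨U.sub_mem ((hV (v : E)).1 v.2).1 (Hop_mem_U hV' hQs _), by rw [map_sub, Qm_Hop hV' hQs, sub_self]⟩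

/-- No zero modes of `∂H_{k−1,Ax}` on `W = δ(QB)δ_{Ax}(B)` (from the no-zero-modes claim for ∂ on the `k`-th constraint subspace) — the
hypothesis under which the operator formula for `C^{(k−1)}` satisfies (4.3.3). [cite: BalabanImbrieJaffe1985, (4.3.3) p.311] -/
theorem noZeroModes_W (hV' : ∀ A : E, A ∈ V' ↔ A ∈ U ∧ Qm A = 0) (hV : ∀ A : E, A ∈ V ↔ A ∈ U ∧ Qm A ∈ W)
    (hQs : ∀ B : E₁, Qs B ∈ U ∧ Qm (Qs B) = B) (hD : ∀ v : V, D (v : E) = 0 → v = 0) (w : W)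
    (hw : D (Hop V' D Qs (w : E₁)) = 0) : w = 0 := by
  have h := hD ⟨Hop V' D Qs (w : E₁), Hop_mem_next hV' hV hQs w.2⟩ hw
  have h1 : Hop V' D Qs (w : E₁) = 0 := by
    have := congrArg (fun v : V => (v : E)) h
    simpa using this
  have h2 : (w : E₁) = 0 := by rw [← Qm_Hop (D := D) hV' hQs (w : E₁), h1, map_zero]
  exact Subtype.ext h2

/-! ## §2  (5.2.3): the translation `A = A′ + H_{k−1,Ax}B` as a change of variables `W × V′ ≅ V` -/

variable [FiniteDimensional ℝ E₁] [MeasurableSpace E] [BorelSpace E] [MeasurableSpace E₁] [BorelSpace E₁]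

/-- **(5.2.3)** — *"translate the integrand with respect to A to the minimum of the quadratic form … under the restriction Q_{k−1}A = B
and the appropriate axial gauge. The minimum is achieved at H_{k−1,Ax}B, so we write A = A′ + H_{k−1,Ax}B. (5.2.3)"* together with the
decomposition `δ(Q_kA)δ_{k,Ax}(A) = ∫𝒟Bδ(QB)δ(Q_{k−1}A − B)δ_{Ax}(B)δ_{k−1,Ax}(A)`: the map `(B, A′) ↦ H_{k−1,Ax}B + A′` is a linear
isomorphism of `W × V′` onto `V`, so that for the volumes `∫_V f(A)dA = c∫_W∫_{V′} f(H_{k−1,Ax}B + A′)dA′dB` with ONE constant `c > 0`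
(the Jacobian; it cancels against the normalizations below). [cite: BalabanImbrieJaffe1985, (5.2.3) p.316] -/
theorem exists_jacobian (hV' : ∀ A : E, A ∈ V' ↔ A ∈ U ∧ Qm A = 0) (hV : ∀ A : E, A ∈ V ↔ A ∈ U ∧ Qm A ∈ W)
    (hQs : ∀ B : E₁, Qs B ∈ U ∧ Qm (Qs B) = B) :
    ∃ c : ℝ, 0 < c ∧ ∀ f : E → ℝ,
      ∫ v : V, f (v : E) = c * ∫ p : W × V', f (Hop V' D Qs (p.1 : E₁) + (p.2 : E)) := by
  set H := Hop V' D Qs with hH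
  -- the linear map (B, A′) ↦ H B + A′, valued in V
  let φ : (W × V') →ₗ[ℝ] E := H ∘ₗ W.subtype ∘ₗ LinearMap.fst ℝ W V' + V'.subtype ∘ₗ LinearMap.snd ℝ W V'
  have hφ : ∀ p : W × V', φ p = H (p.1 : E₁) + (p.2 : E) := fun p => rfl
  have hφV : ∀ p : W × V', φ p ∈ V := fun p => by
    rw [hφ]; exact V.add_mem (Hop_mem_next hV' hV hQs p.1.2) (le_next hV' hV p.2.2)
  let Φl : (W × V') →ₗ[ℝ] V := LinearMap.codRestrict V φ hφV
  have hΦl : ∀ p : W × V', (Φl p : E) = H (p.1 : E₁) + (p.2 : E) := fun p => rfl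
  have hinj : Function.Injective Φl := by
    rw [← LinearMap.ker_eq_bot, LinearMap.ker_eq_bot']
    intro p hp
    have h0 : H (p.1 : E₁) + (p.2 : E) = 0 := by rw [← hΦl, hp]; rfl
    have h1 : (p.1 : E₁) = 0 := by
      have := congrArg Qm h0
      rw [map_add, Qm_Hop hV' hQs, Qm_prev hV' p.2, add_zero, map_zero] at this
      exact this
    have h2 : (p.2 : E) = 0 := by rw [h1, map_zero, zero_add] at h0; exact h0
    exact Prod.ext (Subtype.ext h1) (Subtype.ext h2)
  have hsurj : Function.Surjective Φl := by
    intro v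
    refine ⟨(⟨Qm (v : E), Qm_mem_W hV v⟩, ⟨(v : E) - H (Qm (v : E)), sub_Hop_mem_prev hV' hV hQs v⟩), ?_⟩
    apply Subtype.ext
    rw [hΦl]
    simp only
    abel
  let Φ : (W × V') ≃ₗ[ℝ] V := LinearEquiv.ofBijective Φl ⟨hinj, hsurj⟩
  have hΦ : ∀ p : W × V', ((Φ p : V) : E) = H (p.1 : E₁) + (p.2 : E) := fun p => rfl
  -- Haar measures: the image of the product volume is a constant multiple of the volume of V
  haveI iW : (volume : Measure W).IsAddHaarMeasure := isAddHaarMeasure_basis_addHaar _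
  haveI iV' : (volume : Measure V').IsAddHaarMeasure := isAddHaarMeasure_basis_addHaar _
  haveI iV : (volume : Measure V).IsAddHaarMeasure := isAddHaarMeasure_basis_addHaar _
  haveI iP : (volume : Measure (W × V')).IsAddHaarMeasure := by
    rw [Measure.volume_eq_prod]; exact Measure.prod.instIsAddHaarMeasure _ _
  let e : (W × V') ≃L[ℝ] V := Φ.toContinuousLinearEquiv
  haveI : (Measure.map e (volume : Measure (W × V'))).IsAddHaarMeasure := e.isAddHaarMeasure_map _
  set c : ℝ≥0 := Measure.addHaarScalarFactor (Measure.map e (volume : Measure (W × V'))) (volume : Measure V) with hcdef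
  have hc : 0 < c := Measure.addHaarScalarFactor_pos_of_isAddHaarMeasure _ _
  have hmap : Measure.map e (volume : Measure (W × V')) = c • (volume : Measure V) :=
    Measure.isAddLeftInvariant_eq_smul _ _
  refine ⟨((c : ℝ))⁻¹, by positivity, fun f => ?_⟩
  have h1 : ∫ p : W × V', f (H (p.1 : E₁) + (p.2 : E)) = ∫ v, f (v : E) ∂(Measure.map e volume) := by
    have hme : MeasurableEmbedding (e : (W × V') → V) := e.toHomeomorph.measurableEmbedding
    rw [hme.integral_map]
    rfl
  rw [h1, hmap, integral_smul_nnreal_measure, NNReal.smul_def, smul_eq_mul, ← mul_assoc,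
    inv_mul_cancel₀ (NNReal.coe_pos.2 hc).ne', one_mul]

/-! ## §3  (5.2.4): the integrand factors -/

omit [MeasurableSpace E] [BorelSpace E] [MeasurableSpace E₁] [BorelSpace E₁] in
/-- The integrand of (4.1.1)_k after the translation (5.2.3), verbatim the two factors of (5.2.4):
`exp(−½‖∂(H_{k−1,Ax}B + A′)‖² + ⟨H_{k−1,Ax}B + A′, J⟩) = exp(−½⟨B, Δ_{k−1}B⟩ + ⟨B, H^*_{k−1,Ax}J⟩) · exp(−½‖∂A′‖² + ⟨A′, J⟩)` for `A′` in the
`(k−1)`-constraint subspace — the cross term `⟨∂H_{k−1,Ax}B, ∂A′⟩` vanishes because `H_{k−1,Ax}B` is the minimizer, and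
`‖∂H_{k−1,Ax}B‖² = ⟨B, Δ_{k−1}B⟩`. [cite: BalabanImbrieJaffe1985, (5.2.4) p.316] -/
theorem integrand_split (hV' : ∀ A : E, A ∈ V' ↔ A ∈ U ∧ Qm A = 0) (hV : ∀ A : E, A ∈ V ↔ A ∈ U ∧ Qm A ∈ W)
    (hD : ∀ v : V, D (v : E) = 0 → v = 0) (J : E) (w : W) (v : V') :
    Real.exp (-(1 / 2) * ‖D (Hop V' D Qs (w : E₁) + (v : E))‖ ^ 2 + ⟪Hop V' D Qs (w : E₁) + (v : E), J⟫) =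
      Real.exp (-(1 / 2) * ⟪(w : E₁), deltaOp V' D Qs (w : E₁)⟫ + ⟪(w : E₁), LinearMap.adjoint (Hop V' D Qs) J⟫) *
        Real.exp (-(1 / 2) * ‖D (v : E)‖ ^ 2 + ⟪(v : E), J⟫) := by
  have hD' := noZeroModes_prev hV' hV hD
  rw [← Real.exp_add, norm_sq_D_Hop_add hD' Qs (w : E₁) v, inner_deltaOp, LinearMap.adjoint_inner_right, inner_add_left]
  congr 1
  ring

/-- **(5.2.4)** — *"Inserting this and using (4.1.5) gives exp(½⟨J, G_{k,Ax}J⟩) = Z^{−1}∫𝒟Bδ(QB)δ_{Ax}(B)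
· exp(−½‖∂H_{k−1,Ax}B‖² + ⟨B, H^*_{k−1,Ax}J⟩) · ∫𝒟A′δ(Q_{k−1}A′)δ_{k−1,Ax}(A′) · exp(−½‖∂A′‖² + ⟨A′, J⟩). (5.2.4)"*: the sourced
integral `gen_V(J)` of (4.1.1)_k factors into the sourced integral of (4.3.3)_{k−1} at the source `H^*_{k−1,Ax}J` times the sourced
integral of (4.1.1)_{k−1}, up to the Jacobian `c > 0` of (5.2.3) (one constant for all J). [cite: BalabanImbrieJaffe1985, (5.2.4) p.316] -/
theorem eq524 (hV' : ∀ A : E, A ∈ V' ↔ A ∈ U ∧ Qm A = 0) (hV : ∀ A : E, A ∈ V ↔ A ∈ U ∧ Qm A ∈ W)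
    (hQs : ∀ B : E₁, Qs B ∈ U ∧ Qm (Qs B) = B) (hD : ∀ v : V, D (v : E) = 0 → v = 0) :
    ∃ c : ℝ, 0 < c ∧ ∀ J : E,
      gen V D J = c * (unitGen W (deltaOp V' D Qs) (LinearMap.adjoint (Hop V' D Qs) J) * gen V' D J) := by
  obtain ⟨c, hc, hcov⟩ := exists_jacobian (D := D) hV' hV hQs
  refine ⟨c, hc, fun J => ?_⟩
  unfold gen unitGen
  rw [hcov (fun A => Real.exp (-(1 / 2) * ‖D A‖ ^ 2 + ⟪A, J⟫))]
  congr 1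
  simp only [integrand_split hV' hV hD J]
  rw [Measure.volume_eq_prod]
  exact integral_prod_mul (μ := (volume : Measure W)) (ν := (volume : Measure V'))
    (fun w : W => Real.exp (-(1 / 2) * ⟪(w : E₁), deltaOp V' D Qs (w : E₁)⟫ + ⟪(w : E₁), LinearMap.adjoint (Hop V' D Qs) J⟫))
    (fun v : V' => Real.exp (-(1 / 2) * ‖D (v : E)‖ ^ 2 + ⟪(v : E), J⟫))

omit [FiniteDimensional ℝ F] in
/-- The normalization of (4.1.1) is its sourced integral at `J = 0` (*"Z_{k,Ax} can be computed by setting J = 0"*).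
[cite: BalabanImbrieJaffe1985, (4.1.1) p.309] -/
theorem gen_zero (V₀ : Submodule ℝ E) (D₀ : E →ₗ[ℝ] F) : gen V₀ D₀ 0 = Z V₀ D₀ := by
  unfold gen Z
  simp only [inner_zero_right, add_zero]

/-- The normalization `Z^{(k)}` of (4.3.3) is its sourced integral at `J = 0`. [cite: BalabanImbrieJaffe1985, (4.3.3) p.311] -/
theorem unitGen_zero (W₀ : Submodule ℝ E₁) (Δ : E₁ →ₗ[ℝ] E₁) : unitGen W₀ Δ 0 = unitZ W₀ Δ := by
  unfold unitGen unitZ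
  simp only [inner_zero_right, add_zero]

/-- **The normalizations**: `Z_{k,Ax} = c · Z^{(k−1)} · Z_{k−1,Ax}` with the Jacobian `c` of (5.2.3)/(5.2.4) ((5.2.4) at J = 0) — the
content of the factor *"ZZ^{−1}_{k−1,Ax}"* in (5.2.5). [cite: BalabanImbrieJaffe1985, (5.2.5) p.316] -/
theorem Z_eq (hV' : ∀ A : E, A ∈ V' ↔ A ∈ U ∧ Qm A = 0) (hV : ∀ A : E, A ∈ V ↔ A ∈ U ∧ Qm A ∈ W)
    (hQs : ∀ B : E₁, Qs B ∈ U ∧ Qm (Qs B) = B) (hD : ∀ v : V, D (v : E) = 0 → v = 0) :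
    ∃ c : ℝ, 0 < c ∧ (∀ J : E,
      gen V D J = c * (unitGen W (deltaOp V' D Qs) (LinearMap.adjoint (Hop V' D Qs) J) * gen V' D J)) ∧
      Z V D = c * (unitZ W (deltaOp V' D Qs) * Z V' D) := by
  obtain ⟨c, hc, h⟩ := eq524 hV' hV hQs hD
  refine ⟨c, hc, h, ?_⟩
  have h0 := h 0
  rwa [map_zero, gen_zero, gen_zero, unitGen_zero] at h0

/-! ## §4  (5.2.5) and the recursion (5.2.1) -/

/-- **(5.2.5)** — *"The A′ integral yields Z_{k−1,Ax}exp(½⟨J, G_{k−1,Ax}J⟩), while the B integral gives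
ZZ^{−1}_{k−1,Ax}exp(½⟨H^*_{k−1,Ax}J, C^{(k−1)}H^*_{k−1,Ax}J⟩). (5.2.5)"*: for every `C^{(k−1)}` satisfying (4.3.3) (with the action Δ_{k−1}),
`gen_V(J) = [Z_{k,Ax}Z^{−1}_{k−1,Ax}exp(½⟨H^*_{k−1,Ax}J, C^{(k−1)}H^*_{k−1,Ax}J⟩)] · [∫_{V′}e^{−½‖∂A′‖² + ⟨A′,J⟩}dA′]`, the B integral with
its Jacobian evaluated. [cite: BalabanImbrieJaffe1985, (5.2.5) p.316] -/
theorem eq525 (hV' : ∀ A : E, A ∈ V' ↔ A ∈ U ∧ Qm A = 0) (hV : ∀ A : E, A ∈ V ↔ A ∈ U ∧ Qm A ∈ W)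
    (hQs : ∀ B : E₁, Qs B ∈ U ∧ Qm (Qs B) = B) (hD : ∀ v : V, D (v : E) = 0 → v = 0)
    {C : E₁ →ₗ[ℝ] E₁} (hC : IsUnitPropagator W (deltaOp V' D Qs) C) (J : E) :
    gen V D J = Z V D * (Z V' D)⁻¹ *
      Real.exp ((1 / 2) * ⟪LinearMap.adjoint (Hop V' D Qs) J, C (LinearMap.adjoint (Hop V' D Qs) J)⟫) * gen V' D J := by
  obtain ⟨c, _, h, hZ⟩ := Z_eq hV' hV hQs hD
  set J' := LinearMap.adjoint (Hop V' D Qs) J with hJ'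
  have hD' := noZeroModes_prev hV' hV hD
  have hZ' : Z V' D ≠ 0 := (isAxialPropagator_axialPropagator V' D hD').2.ne'
  have hZW : unitZ W (deltaOp V' D Qs) ≠ 0 :=
    (isUnitPropagator_unitPropagator V' D Qs W (noZeroModes_W hV' hV hQs hD)).2.ne'
  -- (4.3.3) at the source H^* J
  have hCJ : unitGen W (deltaOp V' D Qs) J' = unitZ W (deltaOp V' D Qs) * Real.exp ((1 / 2) * ⟪J', C J'⟫) := by
    rw [hC J', ← mul_assoc, mul_inv_cancel₀ hZW, one_mul]
  rw [h J, hZ, hCJ]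
  conv_rhs => rw [← mul_assoc c, mul_inv_cancel_right₀ hZ']
  ring

/-- **(5.2.1) at the level of the quadratic forms** — *"Thus (5.2.1) holds"*: for ALL operators `G_{k,Ax}`, `G_{k−1,Ax}` satisfying the
functional-integral definition (4.1.1) on the `k`-th and `(k−1)`-th constraint subspaces and every `C^{(k−1)}` satisfying (4.3.3),
`⟨J, G_{k,Ax}J⟩ = ⟨J, (H_{k−1,Ax}C^{(k−1)}H^*_{k−1,Ax} + G_{k−1,Ax})J⟩` for every source J (the Jacobian and the normalizations cancel:
`Z = cZ^{(k−1)}Z_{k−1,Ax}`). [cite: BalabanImbrieJaffe1985, Prop. 5.2.1 (5.2.1) p.316] -/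
theorem prop521_form (hV' : ∀ A : E, A ∈ V' ↔ A ∈ U ∧ Qm A = 0) (hV : ∀ A : E, A ∈ V ↔ A ∈ U ∧ Qm A ∈ W)
    (hQs : ∀ B : E₁, Qs B ∈ U ∧ Qm (Qs B) = B) (hD : ∀ v : V, D (v : E) = 0 → v = 0)
    {Gk G' : E →ₗ[ℝ] E} {C : E₁ →ₗ[ℝ] E₁} (hGk : IsAxialPropagator V D Gk) (hG' : IsAxialPropagator V' D G')
    (hC : IsUnitPropagator W (deltaOp V' D Qs) C) (J : E) :
    ⟪J, Gk J⟫ = ⟪J, (Hop V' D Qs ∘ₗ C ∘ₗ LinearMap.adjoint (Hop V' D Qs) + G') J⟫ := by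
  have hZpos : 0 < Z V D := (isAxialPropagator_axialPropagator V D hD).2
  -- (4.1.1)_k, with gen_V factored by (5.2.5)
  have h1 : Real.exp ((1 / 2) * ⟪J, Gk J⟫) =
      Real.exp ((1 / 2) * ⟪LinearMap.adjoint (Hop V' D Qs) J, C (LinearMap.adjoint (Hop V' D Qs) J)⟫) *
        ((Z V' D)⁻¹ * gen V' D J) := by
    rw [hGk J, eq525 hV' hV hQs hD hC J, mul_assoc (Z V D), mul_assoc (Z V D), inv_mul_cancel_left₀ hZpos.ne']
    ring
  -- (4.1.1)_{k−1}
  rw [← hG' J, ← Real.exp_add] at h1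
  have h2 := Real.exp_injective h1
  have h3 : ⟪J, Gk J⟫ = ⟪LinearMap.adjoint (Hop V' D Qs) J, C (LinearMap.adjoint (Hop V' D Qs) J)⟫ + ⟪J, G' J⟫ := by
    linarith
  rw [h3, LinearMap.add_apply, inner_add_right, LinearMap.comp_apply, LinearMap.comp_apply,
    ← LinearMap.adjoint_inner_left (Hop V' D Qs)]

omit [FiniteDimensional ℝ E] [MeasurableSpace E] [BorelSpace E] [NormedAddCommGroup F] [InnerProductSpace ℝ F]
  [FiniteDimensional ℝ F] [NormedAddCommGroup E₁] [InnerProductSpace ℝ E₁] [FiniteDimensional ℝ E₁] [MeasurableSpace E₁]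
  [BorelSpace E₁] in
/-- Polarization: two symmetric operators with the same quadratic form coincide. [folklore] -/
private theorem eq_of_forms {T T' : E →ₗ[ℝ] E} (hT : ∀ x y, ⟪T x, y⟫ = ⟪x, T y⟫) (hT' : ∀ x y, ⟪T' x, y⟫ = ⟪x, T' y⟫)
    (h : ∀ x, ⟪x, T x⟫ = ⟪x, T' x⟫) : T = T' := by
  have key : ∀ x y, ⟪x, T y⟫ = ⟪x, T' y⟫ := by
    intro x y
    have h1 := h (x + y)
    simp only [map_add, inner_add_left, inner_add_right] at h1
    have h2 := h x
    have h3 := h y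
    have h4 : ⟪y, T x⟫ = ⟪x, T y⟫ := by rw [← hT, real_inner_comm]
    have h5 : ⟪y, T' x⟫ = ⟪x, T' y⟫ := by rw [← hT', real_inner_comm]
    linarith
  ext y
  have h0 := key (T y - T' y) y
  rw [← sub_eq_zero, ← inner_sub_right] at h0
  exact sub_eq_zero.1 (inner_self_eq_zero.1 h0)

omit [MeasurableSpace E] [BorelSpace E] [MeasurableSpace E₁] [BorelSpace E₁] in
/-- `H_{k−1,Ax}C^{(k−1)}H^*_{k−1,Ax} + G_{k−1,Ax}` is symmetric when `C^{(k−1)}` and `G_{k−1,Ax}` are. [cite: BalabanImbrieJaffe1985, (5.2.1) p.316] -/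
theorem rhs521_symm {G' : E →ₗ[ℝ] E} {C : E₁ →ₗ[ℝ] E₁} (hG's : ∀ x y, ⟪G' x, y⟫ = ⟪x, G' y⟫)
    (hCs : ∀ x y, ⟪C x, y⟫ = ⟪x, C y⟫) (x y : E) :
    ⟪(Hop V' D Qs ∘ₗ C ∘ₗ LinearMap.adjoint (Hop V' D Qs) + G') x, y⟫ =
      ⟪x, (Hop V' D Qs ∘ₗ C ∘ₗ LinearMap.adjoint (Hop V' D Qs) + G') y⟫ := by
  simp only [LinearMap.add_apply, LinearMap.comp_apply, inner_add_left, inner_add_right]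
  rw [hG's, ← LinearMap.adjoint_inner_right (Hop V' D Qs), hCs, LinearMap.adjoint_inner_left]

/-- **Proposition 5.2.1, (5.2.1) as an OPERATOR identity** for symmetric operators: if `G_{k,Ax}`, `G_{k−1,Ax}` are symmetric and satisfy
(4.1.1) on the `k`-th / `(k−1)`-th constraint subspaces and `C^{(k−1)}` is symmetric and satisfies (4.3.3), then
`G_{k,Ax} = H_{k−1,Ax}C^{(k−1)}H^*_{k−1,Ax} + G_{k−1,Ax}`. [cite: BalabanImbrieJaffe1985, Prop. 5.2.1 (5.2.1) p.316] -/
theorem prop521_of_symm (hV' : ∀ A : E, A ∈ V' ↔ A ∈ U ∧ Qm A = 0) (hV : ∀ A : E, A ∈ V ↔ A ∈ U ∧ Qm A ∈ W)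
    (hQs : ∀ B : E₁, Qs B ∈ U ∧ Qm (Qs B) = B) (hD : ∀ v : V, D (v : E) = 0 → v = 0)
    {Gk G' : E →ₗ[ℝ] E} {C : E₁ →ₗ[ℝ] E₁} (hGk : IsAxialPropagator V D Gk) (hG' : IsAxialPropagator V' D G')
    (hC : IsUnitPropagator W (deltaOp V' D Qs) C) (hGks : ∀ x y, ⟪Gk x, y⟫ = ⟪x, Gk y⟫)
    (hG's : ∀ x y, ⟪G' x, y⟫ = ⟪x, G' y⟫) (hCs : ∀ x y, ⟪C x, y⟫ = ⟪x, C y⟫) :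
    Gk = Hop V' D Qs ∘ₗ C ∘ₗ LinearMap.adjoint (Hop V' D Qs) + G' :=
  eq_of_forms hGks (rhs521_symm hG's hCs) (prop521_form hV' hV hQs hD hGk hG' hC)

/-- **Proposition 5.2.1 (printed "Proposition 6.2"), the recursion (5.2.1) verbatim for the operator formulas**:
`G_{k,Ax} = H_{k−1,Ax}C^{(k−1)}H^*_{k−1,Ax} + G_{k−1,Ax}` with `G_{k,Ax} = …BIJ85AxialPropagator411.axialPropagator V D`,
`G_{k−1,Ax} = axialPropagator V′ D`, `H_{k−1,Ax} = …BIJ85UnitPropagator433.Hop V′ D Q^{s*}_{k−1}`, `C^{(k−1)} = unitPropagator V′ D Q^{s*}_{k−1} W` —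
PROVED along (5.2.3)–(5.2.5) from (4.1.1), (4.1.5), (4.3.3), given the p. 309 no-zero-modes claim on the `k`-th constraint subspace.
[cite: BalabanImbrieJaffe1985, Prop. 5.2.1 (5.2.1) p.316] -/
theorem prop521 (hV' : ∀ A : E, A ∈ V' ↔ A ∈ U ∧ Qm A = 0) (hV : ∀ A : E, A ∈ V ↔ A ∈ U ∧ Qm A ∈ W)
    (hQs : ∀ B : E₁, Qs B ∈ U ∧ Qm (Qs B) = B) (hD : ∀ v : V, D (v : E) = 0 → v = 0) :
    axialPropagator V D =
      Hop V' D Qs ∘ₗ unitPropagator V' D Qs W ∘ₗ LinearMap.adjoint (Hop V' D Qs) + axialPropagator V' D := by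
  have hD' := noZeroModes_prev hV' hV hD
  have hT := noZeroModes_W hV' hV hQs hD
  exact prop521_of_symm hV' hV hQs hD (isAxialPropagator_axialPropagator V D hD).1
    (isAxialPropagator_axialPropagator V' D hD').1 (isUnitPropagator_unitPropagator V' D Qs W hT).1
    (axialPropagator_symm hD) (axialPropagator_symm hD') (unitPropagator_symm V' D Qs W hT)

/-- (5.2.1) applied to a source: `G_{k,Ax}J = H_{k−1,Ax}C^{(k−1)}H^*_{k−1,Ax}J + G_{k−1,Ax}J`. [cite: BalabanImbrieJaffe1985, Prop. 5.2.1 (5.2.1) p.316] -/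
theorem prop521_apply (hV' : ∀ A : E, A ∈ V' ↔ A ∈ U ∧ Qm A = 0) (hV : ∀ A : E, A ∈ V ↔ A ∈ U ∧ Qm A ∈ W)
    (hQs : ∀ B : E₁, Qs B ∈ U ∧ Qm (Qs B) = B) (hD : ∀ v : V, D (v : E) = 0 → v = 0) (J : E) :
    axialPropagator V D J =
      Hop V' D Qs (unitPropagator V' D Qs W (LinearMap.adjoint (Hop V' D Qs) J)) + axialPropagator V' D J := by
  rw [prop521 hV' hV hQs hD]
  rfl

/-! ## PART III  Bridges between the two vocabularies of this union (p30 gen 3 `HaxOp` ↔ p09 gen 2 `Hop`) -/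

section Bridge

variable {E₀ F₀ E₂ : Type*} [NormedAddCommGroup E₀] [InnerProductSpace ℝ E₀] [FiniteDimensional ℝ E₀]
  [NormedAddCommGroup F₀] [InnerProductSpace ℝ F₀] [FiniteDimensional ℝ F₀]
  [NormedAddCommGroup E₂] [InnerProductSpace ℝ E₂] [FiniteDimensional ℝ E₂]

omit [FiniteDimensional ℝ E₂] in
/-- The two linear packagings of `H_{k,Ax}` in this file agree: `…BIJ85UnitPropagator433.Hop V D Qs = HaxOp V D Qs` (both are the
minimizing configuration of the class of `Q^{s*}B`). [cite: BalabanImbrieJaffe1985, (4.1.3) p.310] -/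
theorem Hop_eq_HaxOp (V : Submodule ℝ E₀) (D : E₀ →ₗ[ℝ] F₀) (Qs : E₂ →ₗ[ℝ] E₀) : Hop V D Qs = HaxOp V D Qs := by
  ext B
  rw [Hop_apply, HaxOp_eq_minimizer]

/-- The two packagings of `C^{(k−1)}` agree: `unitPropagator V D Qs W = axialPropagator W (∂ ∘ HaxOp V D Qs)`.
[cite: BalabanImbrieJaffe1985, (4.3.3) p.311] -/
theorem unitPropagator_eq (V : Submodule ℝ E₀) (D : E₀ →ₗ[ℝ] F₀) (Qs : E₂ →ₗ[ℝ] E₀) (W : Submodule ℝ E₂) :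
    unitPropagator V D Qs W = axialPropagator W (D ∘ₗ HaxOp V D Qs) := by
  unfold unitPropagator
  rw [Hop_eq_HaxOp]

/-- The right members of PART I's `eq521` and PART II's `prop521` are the same operator. [cite: BalabanImbrieJaffe1985, Prop. 5.2.1 (5.2.1) p.316] -/
theorem prop521_eq521 (V' : Submodule ℝ E₀) (D : E₀ →ₗ[ℝ] F₀) (Qs : E₂ →ₗ[ℝ] E₀) (W : Submodule ℝ E₂) :
    Hop V' D Qs ∘ₗ unitPropagator V' D Qs W ∘ₗ LinearMap.adjoint (Hop V' D Qs) =
      HaxOp V' D Qs ∘ₗ axialPropagator W (D ∘ₗ HaxOp V' D Qs) ∘ₗ LinearMap.adjoint (HaxOp V' D Qs) := by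
  rw [unitPropagator_eq, Hop_eq_HaxOp]

end Bridge

end Literature.MathematicalPhysics.QuantumFieldTheory.BalabanImbrieJaffe1984to88.BIJ85Prop521Proof
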